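import Summits.AtomisticToContinuum.HydrodynamicLimit.Theorems.CollisionIsometryCLTAdaptedWeightCLTTLPastDampingPointwise
import Summits.AtomisticToContinuum.HydrodynamicLimit.Theorems.CollisionIsometryCLTAdaptedWeightCLTTLPastDampingTorus

/-!
# Stub `stub_pastDamping` of the line `contact-source-duhamel` — helper file: the PAST INEQUALITY,
INTEGRATED OVER THE TORUS (crux `CollisionIsometryCLT.AdaptedWeightCLT`,
stmt-AtomisticToContinuum-14868, `--supports`)

* `pastSq_le_iform`: the pathwise PAST inequality of `…TLPastDampingPointwise.lean` with the shift
  expanded, at every `(s, z, x)` whose block weights have total `≤ Wm`: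
  `PastSq ≤ 10⁸ (N+1)⁻² Wm · [V⁴ Σ_k w_k dep2_k + V⁶ Σ_k w_k dep3_k + (V⁴ + V⁶) Σ_{k,i} |w_i − w_k| ω_{ki}`
  `+ Σ_k (fast₄ + fast₆)(v_k) (Σ_i w_i ω_{ki} + 3 w_k) + Σ_j w_j (fast₄ + fast₆)(v_j(s))]`
  (window start `y`, its velocities `v_k`, `m` fold steps, positions and velocities `v_j(s)` at `s`);
* `integral_pastSq_le`: its `x`-integral. Every bracket term is an `x`-independent coefficient times
  `w_k(x)`, `|w_i(x) − w_k(x)|` or `Σ_i w_i(x) ω_{ki}`, so with `∫ w_k = 1`, the `L¹`-Lipschitz bound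
  `∫ |w_i − w_k| ≤ lipK · d(x_i(s), x_k(s))` (`…TLPastDampingKernel`), a bound `Λ` for the mass-weighted
  mutual distances `Σ ω_{ki} d(x_i(s), x_k(s))` (supplied by `…TLPastDampingLocality`: `6 S̄ Δ + 6 ε_N m`)
  and the domination of the fast moments by the exponential moment,
  `∫ₓ PastSq ≤ 10⁸ (N+1)⁻² Wm · [Σ_k (V⁴ dep2_k + V⁶ dep3_k) + (V⁴ + V⁶) lipK Λ`
  `+ (N+1)(K₄ + K₆)(6 expMoment(y) + expMoment(Φ_s z))]`, `K_p = p!/(λV)^p`.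
-/

namespace Summit.AtomisticToContinuum.HydrodynamicLimit.Theorems.ContactSourceDuhamel.TimeLocal
namespace PastDamping

open scoped BigOperators Topology Classical MeasureTheory ENNReal InnerProductSpace
open Filter Set MeasureTheory
open Literature.Analysis.FluidPDE
open Literature.MathematicalPhysics.KineticTheory (hsDiameter)

noncomputable section

variable {σ : ℝ} {N : ℕ}

/-! ## The pathwise inequality with the shift expanded -/

/-- **The pathwise PAST inequality, integrable form.** See the module docstring. -/
theorem pastSq_le_iform (Φ : Flow σ N) {φ : ℕ → T3 → ℝ} (hφ0 : ∀ y, 0 ≤ φ N y) (s : ℝ) (z : Cfg N)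
    (x : T3) {V : ℝ} (hV : 0 ≤ V) {Wm : ℝ} (hWm : ∑ i, wgt σ N Φ φ s z x i ≤ Wm) :
    PastSq σ N Φ φ s z x ≤ 10 ^ 8 * ((((N + 1 : ℕ) : ℝ))⁻¹) ^ 2 * Wm *
      (V ^ 4 * ∑ k, wgt σ N Φ φ s z x k *
          dep2 σ N (winStart σ N Φ s z) (steps σ N (winStart σ N Φ s z) (winLen N s)) k +
        V ^ 6 * ∑ k, wgt σ N Φ φ s z x k *
          dep3 σ N (winStart σ N Φ s z) (steps σ N (winStart σ N Φ s z) (winLen N s)) k +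
        (V ^ 4 + V ^ 6) * ∑ k, ∑ i, |wgt σ N Φ φ s z x i - wgt σ N Φ φ s z x k| *
          omegaAt σ N (winStart σ N Φ s z) (steps σ N (winStart σ N Φ s z) (winLen N s)) k i +
        ((∑ k, fastPow 4 V (winStart σ N Φ s z k).2 *
            (∑ i, wgt σ N Φ φ s z x i *
              omegaAt σ N (winStart σ N Φ s z) (steps σ N (winStart σ N Φ s z) (winLen N s)) k i +
              3 * wgt σ N Φ φ s z x k)) +
          ∑ k, fastPow 6 V (winStart σ N Φ s z k).2 *
            (∑ i, wgt σ N Φ φ s z x i *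
              omegaAt σ N (winStart σ N Φ s z) (steps σ N (winStart σ N Φ s z) (winLen N s)) k i +
              3 * wgt σ N Φ φ s z x k)) +
        ((∑ j, wgt σ N Φ φ s z x j * fastPow 4 V (Φ.flow s z j).2) +
          ∑ j, wgt σ N Φ φ s z x j * fastPow 6 V (Φ.flow s z j).2)) := by
  set y := winStart σ N Φ s z with hy
  set m := steps σ N y (winLen N s) with hm
  set w : Fin (N + 1) → ℝ := wgt σ N Φ φ s z x with hw_def
  set u := ubar σ N Φ φ s z x with hu
  set c := ((((N + 1 : ℕ) : ℝ))⁻¹) ^ 2 with hc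
  have hw : ∀ i, 0 ≤ w i := fun i => hφ0 _
  set W := ∑ i, w i with hW
  have hW0 : 0 ≤ W := Finset.sum_nonneg fun i _ => hw i
  have hWm0 : 0 ≤ Wm := hW0.trans hWm
  -- atoms
  set D2 := ∑ k, w k * dep2 σ N y m k with hD2
  set D3 := ∑ k, w k * dep3 σ N y m k with hD3
  set Θ := ∑ k, ∑ i, |w i - w k| * omegaAt σ N y m k i with hΘ
  set Fy4 := ∑ k, w k * fastPow 4 V (y k).2 with hFy4
  set Fy6 := ∑ k, w k * fastPow 6 V (y k).2 with hFy6
  set Gy4 := ∑ k, fastPow 4 V (y k).2 * (∑ i, w i * omegaAt σ N y m k i + 3 * w k) with hGy4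
  set Gy6 := ∑ k, fastPow 6 V (y k).2 * (∑ i, w i * omegaAt σ N y m k i + 3 * w k) with hGy6
  set F4 := ∑ j, w j * fastPow 4 V (Φ.flow s z j).2 with hF4
  set F6 := ∑ j, w j * fastPow 6 V (Φ.flow s z j).2 with hF6
  have hD2n : 0 ≤ D2 := Finset.sum_nonneg fun k _ => mul_nonneg (hw k) (dep2_nonneg m k)
  have hD3n : 0 ≤ D3 := Finset.sum_nonneg fun k _ => mul_nonneg (hw k) (dep3_nonneg m k)
  have hΘn : 0 ≤ Θ := Finset.sum_nonneg fun k _ => Finset.sum_nonneg fun i _ =>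
    mul_nonneg (abs_nonneg _) (omegaAt_nonneg m k i)
  have hF4n : 0 ≤ F4 := Finset.sum_nonneg fun j _ => mul_nonneg (hw j) (fastPow_nonneg _ _ _)
  have hF6n : 0 ≤ F6 := Finset.sum_nonneg fun j _ => mul_nonneg (hw j) (fastPow_nonneg _ _ _)
  have hGy4n : 0 ≤ Gy4 := Finset.sum_nonneg fun k _ => mul_nonneg (fastPow_nonneg _ _ _)
    (add_nonneg (Finset.sum_nonneg fun i _ => mul_nonneg (hw i) (omegaAt_nonneg m k i))
      (mul_nonneg (by norm_num) (hw k)))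
  have hGy6n : 0 ≤ Gy6 := Finset.sum_nonneg fun k _ => mul_nonneg (fastPow_nonneg _ _ _)
    (add_nonneg (Finset.sum_nonneg fun i _ => mul_nonneg (hw i) (omegaAt_nonneg m k i))
      (mul_nonneg (by norm_num) (hw k)))
  -- `Fy ≤ Gy`
  have hFG : ∀ p, ∑ k, w k * fastPow p V (y k).2 ≤
      ∑ k, fastPow p V (y k).2 * (∑ i, w i * omegaAt σ N y m k i + 3 * w k) := by
    intro p
    refine Finset.sum_le_sum fun k _ => ?_
    rw [mul_comm]
    refine mul_le_mul_of_nonneg_left ?_ (fastPow_nonneg _ _ _)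
    have h0 : 0 ≤ ∑ i, w i * omegaAt σ N y m k i :=
      Finset.sum_nonneg fun i _ => mul_nonneg (hw i) (omegaAt_nonneg m k i)
    linarith [hw k]
  have hFG4 : Fy4 ≤ Gy4 := hFG 4
  have hFG6 : Fy6 ≤ Gy6 := hFG 6
  -- the algebraic bound
  have hPS : PastSq σ N Φ φ s z x = (∑ j : Fin 3, ∑ k' : Fin 3, (pastF 2 σ N y m w u (C2 j k')) ^ 2) +
      ∑ a₀ : Fin 3, (pastF 3 σ N y m w u (C3 a₀)) ^ 2 := rfl
  have h1 : PastSq σ N Φ φ s z x ≤ 2 * c * W *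
      (9 * ((∑ k, w k * (225 * ((‖(y k).2 - u‖ ^ 2) ^ 2 * dep2 σ N y m k))) +
          6 * ∑ k, ∑ i, |w i - w k| * omegaAt σ N y m k i * (‖(y k).2 - u‖ ^ 2) ^ 2) +
        3 * ((∑ k, w k * (90 * ((‖(y k).2 - u‖ ^ 2) ^ 3 * dep3 σ N y m k))) +
          6 * ∑ k, ∑ i, |w i - w k| * omegaAt σ N y m k i * (‖(y k).2 - u‖ ^ 2) ^ 3)) := by
    rw [hPS]
    exact sum_sq_pastF_le (σ := σ) (y := y) hw m u
  -- mean term, rank 2: `θ_k = 225 w_k dep2_k`, `c = 1350`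
  have hM2 : ∑ k, w k * (225 * ((‖(y k).2 - u‖ ^ 2) ^ 2 * dep2 σ N y m k)) ≤
      8 * (9 * V ^ 4 * (225 * D2) + 1350 * Fy4 + 8 * 1350 * F4) := by
    have hθ : ∀ k, 0 ≤ 225 * (w k * dep2 σ N y m k) := fun k =>
      mul_nonneg (by norm_num) (mul_nonneg (hw k) (dep2_nonneg m k))
    have hθW : ∑ k, 225 * (w k * dep2 σ N y m k) ≤ 1350 * ∑ i, w i := by
      calc ∑ k, 225 * (w k * dep2 σ N y m k) ≤ ∑ k, 225 * (w k * 6) :=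
            Finset.sum_le_sum fun k _ => mul_le_mul_of_nonneg_left
              (mul_le_mul_of_nonneg_left (dep2_le m k) (hw k)) (by norm_num)
        _ = 1350 * ∑ i, w i := by rw [Finset.mul_sum]; exact Finset.sum_congr rfl fun k _ => by ring
    have h := sum_mul_shift_pow_two_le Φ hφ0 s z x (fun k => (y k).2) hθ (by norm_num) hθW hV
    have hfast : ∑ k, 225 * (w k * dep2 σ N y m k) * fastPow 4 V (y k).2 ≤ 1350 * Fy4 := by
      rw [hFy4, Finset.mul_sum]
      refine Finset.sum_le_sum fun k _ => ?_
      have := dep2_le (σ := σ) (y := y) m k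
      have := fastPow_nonneg 4 V (y k).2
      nlinarith [hw k, mul_nonneg (hw k) this]
    have heq : ∑ k, w k * (225 * ((‖(y k).2 - u‖ ^ 2) ^ 2 * dep2 σ N y m k)) =
        ∑ k, 225 * (w k * dep2 σ N y m k) * (‖(y k).2 - u‖ ^ 2) ^ 2 :=
      Finset.sum_congr rfl fun k _ => by ring
    have hsum : ∑ k, 225 * (w k * dep2 σ N y m k) = 225 * D2 := by rw [hD2, Finset.mul_sum]
    rw [heq]
    rw [hsum] at h
    linarith [h, hfast]
  -- mean term, rank 3: `θ_k = 90 w_k dep3_k`, `c = 7020`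
  have hM3 : ∑ k, w k * (90 * ((‖(y k).2 - u‖ ^ 2) ^ 3 * dep3 σ N y m k)) ≤
      32 * (33 * V ^ 6 * (90 * D3) + 7020 * Fy6 + 32 * 7020 * F6) := by
    have hθ : ∀ k, 0 ≤ 90 * (w k * dep3 σ N y m k) := fun k =>
      mul_nonneg (by norm_num) (mul_nonneg (hw k) (dep3_nonneg m k))
    have hθW : ∑ k, 90 * (w k * dep3 σ N y m k) ≤ 7020 * ∑ i, w i := by
      calc ∑ k, 90 * (w k * dep3 σ N y m k) ≤ ∑ k, 90 * (w k * 78) :=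
            Finset.sum_le_sum fun k _ => mul_le_mul_of_nonneg_left
              (mul_le_mul_of_nonneg_left (dep3_le m k) (hw k)) (by norm_num)
        _ = 7020 * ∑ i, w i := by rw [Finset.mul_sum]; exact Finset.sum_congr rfl fun k _ => by ring
    have h := sum_mul_shift_pow_three_le Φ hφ0 s z x (fun k => (y k).2) hθ (by norm_num) hθW hV
    have hfast : ∑ k, 90 * (w k * dep3 σ N y m k) * fastPow 6 V (y k).2 ≤ 7020 * Fy6 := by
      rw [hFy6, Finset.mul_sum]
      refine Finset.sum_le_sum fun k _ => ?_
      have := dep3_le (σ := σ) (y := y) m k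
      have := fastPow_nonneg 6 V (y k).2
      nlinarith [hw k, mul_nonneg (hw k) this]
    have heq : ∑ k, w k * (90 * ((‖(y k).2 - u‖ ^ 2) ^ 3 * dep3 σ N y m k)) =
        ∑ k, 90 * (w k * dep3 σ N y m k) * (‖(y k).2 - u‖ ^ 2) ^ 3 :=
      Finset.sum_congr rfl fun k _ => by ring
    have hsum : ∑ k, 90 * (w k * dep3 σ N y m k) = 90 * D3 := by rw [hD3, Finset.mul_sum]
    rw [heq]
    rw [hsum] at h
    linarith [h, hfast]
  -- remainders: `θ_k = Σ_i |w_i − w_k| ω_ki`, `c = 6`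
  have hθR : ∀ k, 0 ≤ ∑ i, |w i - w k| * omegaAt σ N y m k i := fun k =>
    Finset.sum_nonneg fun i _ => mul_nonneg (abs_nonneg _) (omegaAt_nonneg m k i)
  have hθRW : ∑ k, ∑ i, |w i - w k| * omegaAt σ N y m k i ≤ 6 * ∑ i, w i :=
    sum_abs_sub_mul_omegaAt_le hw m
  have hθfast : ∀ p, ∑ k, (∑ i, |w i - w k| * omegaAt σ N y m k i) * fastPow p V (y k).2 ≤
      ∑ k, fastPow p V (y k).2 * (∑ i, w i * omegaAt σ N y m k i + 3 * w k) := by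
    intro p
    refine Finset.sum_le_sum fun k _ => ?_
    rw [mul_comm]
    refine mul_le_mul_of_nonneg_left ?_ (fastPow_nonneg _ _ _)
    calc ∑ i, |w i - w k| * omegaAt σ N y m k i ≤ ∑ i, (w i + w k) * omegaAt σ N y m k i :=
          Finset.sum_le_sum fun i _ => mul_le_mul_of_nonneg_right ((abs_sub _ _).trans
            (by rw [abs_of_nonneg (hw i), abs_of_nonneg (hw k)])) (omegaAt_nonneg m k i)
      _ = ∑ i, w i * omegaAt σ N y m k i + 3 * w k := by
          simp only [add_mul, Finset.sum_add_distrib, ← Finset.mul_sum, sum_carriers_omegaAt]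
          ring
  have hR2 : ∑ k, ∑ i, |w i - w k| * omegaAt σ N y m k i * (‖(y k).2 - u‖ ^ 2) ^ 2 ≤
      8 * (9 * V ^ 4 * Θ + Gy4 + 8 * 6 * F4) := by
    have h := sum_mul_shift_pow_two_le Φ hφ0 s z x (fun k => (y k).2) hθR (by norm_num) hθRW hV
    have heq : ∑ k, ∑ i, |w i - w k| * omegaAt σ N y m k i * (‖(y k).2 - u‖ ^ 2) ^ 2 =
        ∑ k, (∑ i, |w i - w k| * omegaAt σ N y m k i) * (‖(y k).2 - u‖ ^ 2) ^ 2 :=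
      Finset.sum_congr rfl fun k _ => by rw [Finset.sum_mul]
    rw [heq]
    linarith [h, hθfast 4]
  have hR3 : ∑ k, ∑ i, |w i - w k| * omegaAt σ N y m k i * (‖(y k).2 - u‖ ^ 2) ^ 3 ≤
      32 * (33 * V ^ 6 * Θ + Gy6 + 32 * 6 * F6) := by
    have h := sum_mul_shift_pow_three_le Φ hφ0 s z x (fun k => (y k).2) hθR (by norm_num) hθRW hV
    have heq : ∑ k, ∑ i, |w i - w k| * omegaAt σ N y m k i * (‖(y k).2 - u‖ ^ 2) ^ 3 =
        ∑ k, (∑ i, |w i - w k| * omegaAt σ N y m k i) * (‖(y k).2 - u‖ ^ 2) ^ 3 :=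
      Finset.sum_congr rfl fun k _ => by rw [Finset.sum_mul]
    rw [heq]
    linarith [h, hθfast 6]
  -- assemble
  have hV4 : 0 ≤ V ^ 4 := pow_nonneg hV 4
  have hV6 : 0 ≤ V ^ 6 := pow_nonneg hV 6
  have hbr : 9 * ((∑ k, w k * (225 * ((‖(y k).2 - u‖ ^ 2) ^ 2 * dep2 σ N y m k))) +
          6 * ∑ k, ∑ i, |w i - w k| * omegaAt σ N y m k i * (‖(y k).2 - u‖ ^ 2) ^ 2) +
        3 * ((∑ k, w k * (90 * ((‖(y k).2 - u‖ ^ 2) ^ 3 * dep3 σ N y m k))) +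
          6 * ∑ k, ∑ i, |w i - w k| * omegaAt σ N y m k i * (‖(y k).2 - u‖ ^ 2) ^ 3) ≤
      5 * 10 ^ 7 * (V ^ 4 * D2 + V ^ 6 * D3 + (V ^ 4 + V ^ 6) * Θ + (Gy4 + Gy6) + (F4 + F6)) := by
    linarith [hM2, hM3, hR2, hR3, hFG4, hFG6, mul_nonneg hV4 hD2n, mul_nonneg hV6 hD3n,
      mul_nonneg hV4 hΘn, mul_nonneg hV6 hΘn, hGy4n, hGy6n, hF4n, hF6n]
  have hc0 : 0 ≤ c := sq_nonneg _
  have hatoms : 0 ≤ V ^ 4 * D2 + V ^ 6 * D3 + (V ^ 4 + V ^ 6) * Θ + (Gy4 + Gy6) + (F4 + F6) :=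
    add_nonneg (add_nonneg (add_nonneg (add_nonneg (mul_nonneg hV4 hD2n) (mul_nonneg hV6 hD3n))
      (mul_nonneg (add_nonneg hV4 hV6) hΘn)) (add_nonneg hGy4n hGy6n)) (add_nonneg hF4n hF6n)
  have h2c : 0 ≤ 2 * c := mul_nonneg (by norm_num) hc0
  have hX : 0 ≤ 5 * 10 ^ 7 *
      (V ^ 4 * D2 + V ^ 6 * D3 + (V ^ 4 + V ^ 6) * Θ + (Gy4 + Gy6) + (F4 + F6)) :=
    mul_nonneg (by norm_num) hatoms
  calc PastSq σ N Φ φ s z x ≤ 2 * c * W * (5 * 10 ^ 7 *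
        (V ^ 4 * D2 + V ^ 6 * D3 + (V ^ 4 + V ^ 6) * Θ + (Gy4 + Gy6) + (F4 + F6))) :=
        h1.trans (mul_le_mul_of_nonneg_left hbr (mul_nonneg h2c hW0))
    _ ≤ 2 * c * Wm * (5 * 10 ^ 7 *
        (V ^ 4 * D2 + V ^ 6 * D3 + (V ^ 4 + V ^ 6) * Θ + (Gy4 + Gy6) + (F4 + F6))) :=
        mul_le_mul_of_nonneg_right (mul_le_mul_of_nonneg_left hWm h2c) hX
    _ = _ := by ring

/-- **The PAST inequality integrated over the torus.** For `0 < σ < 1/2`, a good datum `z`, an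
admissible kernel family with `(N+1)^{-γ} < 1/2`, a velocity cut-off `V > 0`, a rate `λ > 0` and a
bound `Wm` for the total block weight at time `s`: see the module docstring. -/
theorem integral_pastSq_le (Φ : Flow σ N) {γ C : ℝ} {φ : ℕ → T3 → ℝ}
    (hadm : AdmissibleKernel γ C φ) (hR : ((N : ℝ) + 1) ^ (-γ) < 1 / 2) (z : Cfg N)
    (s : ℝ) {V lam : ℝ} (hV : 0 < V) (hlam : 0 < lam) {Wm : ℝ}
    (hWm : ∀ x, ∑ i, wgt σ N Φ φ s z x i ≤ Wm) {Λ : ℝ}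
    (hΛ : ∑ k, ∑ i, omegaAt σ N (winStart σ N Φ s z) (steps σ N (winStart σ N Φ s z) (winLen N s)) k i *
      Torus.euclidDist (Φ.flow s z i).1 (Φ.flow s z k).1 ≤ Λ) :
    ∫ x, PastSq σ N Φ φ s z x ≤ 10 ^ 8 * ((((N + 1 : ℕ) : ℝ))⁻¹) ^ 2 * Wm *
      (V ^ 4 * ∑ k, dep2 σ N (winStart σ N Φ s z) (steps σ N (winStart σ N Φ s z) (winLen N s)) k +
        V ^ 6 * ∑ k, dep3 σ N (winStart σ N Φ s z) (steps σ N (winStart σ N Φ s z) (winLen N s)) k +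
        (V ^ 4 + V ^ 6) * (lipK C γ N * Λ) +
        6 * (((N + 1 : ℕ) : ℝ) * (((4 : ℕ).factorial / (lam * V) ^ 4 + (6 : ℕ).factorial / (lam * V) ^ 6) *
          expMoment lam N (winStart σ N Φ s z))) +
        ((N + 1 : ℕ) : ℝ) * (((4 : ℕ).factorial / (lam * V) ^ 4 + (6 : ℕ).factorial / (lam * V) ^ 6) *
          expMoment lam N (Φ.flow s z))) := by
  have hφc : Continuous (φ N) := (hadm.1 N).continuous
  have hφ0 : ∀ y, 0 ≤ φ N y := hadm.2.1 N
  set y := winStart σ N Φ s z with hy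
  set m := steps σ N y (winLen N s) with hm
  set K := 10 ^ 8 * ((((N + 1 : ℕ) : ℝ))⁻¹) ^ 2 * Wm with hK
  have hWm0 : 0 ≤ Wm := (Finset.sum_nonneg fun i _ => hφ0 _).trans (hWm 0)
  have hK0 : 0 ≤ K := mul_nonneg (mul_nonneg (by norm_num) (sq_nonneg _)) hWm0
  have hV0 : 0 ≤ V := hV.le
  -- the five integrands
  set T1 : T3 → ℝ := fun x => ∑ k, wgt σ N Φ φ s z x k * dep2 σ N y m k with hT1
  set T2 : T3 → ℝ := fun x => ∑ k, wgt σ N Φ φ s z x k * dep3 σ N y m k with hT2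
  set T3f : T3 → ℝ := fun x => ∑ k, ∑ i, |wgt σ N Φ φ s z x i - wgt σ N Φ φ s z x k| *
    omegaAt σ N y m k i with hT3
  set T4 : T3 → ℝ := fun x => ∑ k, fastPow 4 V (y k).2 *
    (∑ i, wgt σ N Φ φ s z x i * omegaAt σ N y m k i + 3 * wgt σ N Φ φ s z x k) with hT4
  set T5 : T3 → ℝ := fun x => ∑ k, fastPow 6 V (y k).2 *
    (∑ i, wgt σ N Φ φ s z x i * omegaAt σ N y m k i + 3 * wgt σ N Φ φ s z x k) with hT5
  set T6 : T3 → ℝ := fun x => ∑ j, wgt σ N Φ φ s z x j * fastPow 4 V (Φ.flow s z j).2 with hT6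
  set T7 : T3 → ℝ := fun x => ∑ j, wgt σ N Φ φ s z x j * fastPow 6 V (Φ.flow s z j).2 with hT7
  set G : T3 → ℝ := fun x => K * (V ^ 4 * T1 x + V ^ 6 * T2 x + (V ^ 4 + V ^ 6) * T3f x +
    (T4 x + T5 x) + (T6 x + T7 x)) with hG
  -- pointwise
  have hdom : ∀ x, PastSq σ N Φ φ s z x ≤ G x := fun x => pastSq_le_iform Φ hφ0 s z x hV0 (hWm x)
  -- integrability
  have hw := integrable_wgt Φ hφc s z
  have hI1 : Integrable T1 := integrable_finsetSum _ fun k _ => (hw k).mul_const _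
  have hI2 : Integrable T2 := integrable_finsetSum _ fun k _ => (hw k).mul_const _
  have hI3 : Integrable T3f := integrable_finsetSum _ fun k _ => integrable_finsetSum _ fun i _ =>
    (integrable_abs_wgt_sub Φ hφc s z i k).mul_const _
  have hI45 : ∀ e : Fin (N + 1) → ℝ, Integrable fun x => ∑ k, e k *
      (∑ i, wgt σ N Φ φ s z x i * omegaAt σ N y m k i + 3 * wgt σ N Φ φ s z x k) := fun e =>
    integrable_finsetSum _ fun k _ => ((integrable_finsetSum _ fun i _ => (hw i).mul_const _).add
      ((hw k).const_mul 3)).const_mul (e k)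
  have hI4 : Integrable T4 := hI45 _
  have hI5 : Integrable T5 := hI45 _
  have hI6 : Integrable T6 := integrable_finsetSum _ fun j _ => (hw j).mul_const _
  have hI7 : Integrable T7 := integrable_finsetSum _ fun j _ => (hw j).mul_const _
  have hIG : Integrable G := by
    have h := ((((hI1.const_mul (V ^ 4)).add (hI2.const_mul (V ^ 6))).add
      (hI3.const_mul (V ^ 4 + V ^ 6))).add ((hI4.add hI5).add (hI6.add hI7))).const_mul K
    refine h.congr (ae_of_all _ fun x => ?_)
    simp only [hG, Pi.add_apply]
    ring
  -- the integrals
  have hJ1 : ∫ x, T1 x = ∑ k, dep2 σ N y m k := integral_sum_wgt_mul Φ hadm s z _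
  have hJ2 : ∫ x, T2 x = ∑ k, dep3 σ N y m k := integral_sum_wgt_mul Φ hadm s z _
  have hJ3 : ∫ x, T3f x ≤ lipK C γ N * Λ := by
    refine (integral_sum_abs_sub_mul_le Φ hadm hR s z fun k i => omegaAt_nonneg m k i).trans ?_
    have hC0 : 0 ≤ C := by
      have h := (hadm.2.1 N 0).trans (hadm.2.2.2.2.1 N 0)
      have hpow : 0 < ((N : ℝ) + 1) ^ (3 * γ) := Real.rpow_pos_of_pos (by positivity) _
      nlinarith
    exact mul_le_mul_of_nonneg_left hΛ (lipK_nonneg hC0 γ N)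
  have hJ4 : ∫ x, T4 x = 6 * ∑ k, fastPow 4 V (y k).2 := by
    rw [hT4, integral_sum_mul_sum_wgt Φ hadm s z, Finset.mul_sum]
    refine Finset.sum_congr rfl fun k _ => ?_
    rw [sum_carriers_omegaAt]; ring
  have hJ5 : ∫ x, T5 x = 6 * ∑ k, fastPow 6 V (y k).2 := by
    rw [hT5, integral_sum_mul_sum_wgt Φ hadm s z, Finset.mul_sum]
    refine Finset.sum_congr rfl fun k _ => ?_
    rw [sum_carriers_omegaAt]; ring
  have hJ6 : ∫ x, T6 x = ∑ j, fastPow 4 V (Φ.flow s z j).2 := integral_sum_wgt_mul Φ hadm s z _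
  have hJ7 : ∫ x, T7 x = ∑ j, fastPow 6 V (Φ.flow s z j).2 := integral_sum_wgt_mul Φ hadm s z _
  have hI67 : Integrable fun x => T6 x + T7 x := hI6.add hI7
  have hI45' : Integrable fun x => T4 x + T5 x := hI4.add hI5
  have hI12 : Integrable fun x => V ^ 4 * T1 x + V ^ 6 * T2 x := (hI1.const_mul _).add (hI2.const_mul _)
  have hI3c : Integrable fun x => (V ^ 4 + V ^ 6) * T3f x := hI3.const_mul _
  have hI123 : Integrable fun x => V ^ 4 * T1 x + V ^ 6 * T2 x + (V ^ 4 + V ^ 6) * T3f x := hI12.add hI3c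
  have hIA : Integrable fun x => V ^ 4 * T1 x + V ^ 6 * T2 x + (V ^ 4 + V ^ 6) * T3f x + (T4 x + T5 x) :=
    hI123.add hI45'
  have hB67 : ∫ x, (T6 x + T7 x) = (∫ x, T6 x) + ∫ x, T7 x := integral_add hI6 hI7
  have hB45 : ∫ x, (T4 x + T5 x) = (∫ x, T4 x) + ∫ x, T5 x := integral_add hI4 hI5
  have hB12 : ∫ x, (V ^ 4 * T1 x + V ^ 6 * T2 x) = V ^ 4 * (∫ x, T1 x) + V ^ 6 * (∫ x, T2 x) := by
    rw [integral_add (hI1.const_mul _) (hI2.const_mul _), integral_const_mul, integral_const_mul]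
  have hB123 : ∫ x, (V ^ 4 * T1 x + V ^ 6 * T2 x + (V ^ 4 + V ^ 6) * T3f x) =
      V ^ 4 * (∫ x, T1 x) + V ^ 6 * (∫ x, T2 x) + (V ^ 4 + V ^ 6) * (∫ x, T3f x) := by
    rw [integral_add hI12 hI3c, hB12, integral_const_mul]
  have hBA : ∫ x, (V ^ 4 * T1 x + V ^ 6 * T2 x + (V ^ 4 + V ^ 6) * T3f x + (T4 x + T5 x)) =
      V ^ 4 * (∫ x, T1 x) + V ^ 6 * (∫ x, T2 x) + (V ^ 4 + V ^ 6) * (∫ x, T3f x) +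
        ((∫ x, T4 x) + ∫ x, T5 x) := by
    rw [integral_add hI123 hI45', hB123, hB45]
  have hJG : ∫ x, G x = K * (V ^ 4 * (∫ x, T1 x) + V ^ 6 * (∫ x, T2 x) + (V ^ 4 + V ^ 6) * (∫ x, T3f x) +
      ((∫ x, T4 x) + ∫ x, T5 x) + ((∫ x, T6 x) + ∫ x, T7 x)) := by
    rw [hG]
    dsimp only
    rw [integral_const_mul, integral_add hIA hI67, hBA, hB67]
  -- fast moments
  have hf4y := sum_fastPow_le hlam hV 4 y
  have hf6y := sum_fastPow_le hlam hV 6 y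
  have hf4 := sum_fastPow_le hlam hV 4 (Φ.flow s z)
  have hf6 := sum_fastPow_le hlam hV 6 (Φ.flow s z)
  have hV4 : 0 ≤ V ^ 4 := pow_nonneg hV0 4
  have hV6 : 0 ≤ V ^ 6 := pow_nonneg hV0 6
  calc ∫ x, PastSq σ N Φ φ s z x ≤ ∫ x, G x :=
        integral_mono_of_nonneg (ae_of_all _ fun x => pastSq_nonneg Φ φ s z x) hIG (ae_of_all _ hdom)
    _ = K * (V ^ 4 * (∫ x, T1 x) + V ^ 6 * (∫ x, T2 x) + (V ^ 4 + V ^ 6) * (∫ x, T3f x) +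
      ((∫ x, T4 x) + ∫ x, T5 x) + ((∫ x, T6 x) + ∫ x, T7 x)) := hJG
    _ ≤ K * (V ^ 4 * ∑ k, dep2 σ N y m k + V ^ 6 * ∑ k, dep3 σ N y m k +
        (V ^ 4 + V ^ 6) * (lipK C γ N * Λ) +
        6 * (((N + 1 : ℕ) : ℝ) * (((4 : ℕ).factorial / (lam * V) ^ 4 + (6 : ℕ).factorial / (lam * V) ^ 6) *
          expMoment lam N y)) +
        ((N + 1 : ℕ) : ℝ) * (((4 : ℕ).factorial / (lam * V) ^ 4 + (6 : ℕ).factorial / (lam * V) ^ 6) *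
          expMoment lam N (Φ.flow s z))) := by
        refine mul_le_mul_of_nonneg_left ?_ hK0
        have hJ3' := mul_le_mul_of_nonneg_left hJ3 (add_nonneg hV4 hV6)
        rw [hJ1, hJ2, hJ4, hJ5, hJ6, hJ7]
        linarith [hJ3', hf4y, hf6y, hf4, hf6]

/-- Registered anchor of this helper file (`cd3x` is the average of the per-site rank-3 defects, with
`dep3` unfolded). -/
theorem pastDamping_integrated_anchor : ∀ (σ : ℝ) (N : ℕ) (y : Cfg N) (Δ : ℝ), cd3x σ N y Δ = ((N + 1 : ℕ) : ℝ)⁻¹ * ∑ k : Fin (N + 1), ∑ p : Fin 10, normSqT (cloud 3 σ N y (steps σ N y Δ) k (udir p)) :=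
  fun _ _ _ _ => rfl

end

end PastDamping
end Summit.AtomisticToContinuum.HydrodynamicLimit.Theorems.ContactSourceDuhamel.TimeLocal
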